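import Summits.ResolutionOfSingularities.ResolutionOfSingularities.Theorems.HilbertSamuelEliminationSigmaMaxModificationsCorridor3WLadderChainTower
import HarnessLib

/-!
# [OURS · L1 W4.2] FROM A MOVING CHAIN TO ITS LOCAL TOWER — FACT-FREE CORE (point-centred blown-up stages)
# units-half of `stub_Wlow3M_char` AND of the characteristic-2 row `stub_Wlow3M_two` (crux chain w42, line `w_ladder`;
# `--supports stmt-…-19249`, helper)

OURS (cell res-hironaka, slot W4.2, seat res-L1-w42-stub-2 gen 3); NOT statements of H. Hironaka's manuscript
[Hironaka2017]. AI-drafted, weaker than expert review. Sorry-free PROOF file (no new definition), FACT-FREE: the local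
tower of `…Corridor3WLadderChainTower` (`exists_localTower_of_movingChain_wait`, modulo `CossartJannsenSaito2020_thm_3_14`
in the (F1) regime `QCharRegime p`) is rebuilt from the ONE local consequence of Thm. 3.14 it uses — «at a blown-up
marked point the canonical centre has stalk ideal `𝔪`» — taken as a HYPOTHESIS on the chain, so that one construction
serves the characteristic row (hypothesis discharged by stub-2's `stalkIdeal_centre_eq_maximalIdeal_of_reaches`, CJS
Thm. 3.14 under (F1)) and the characteristic-`2` row (discharged by stub-3's `stalkIdeal_centre_eq_maximalIdeal_of_reaches_geomDir`,
the (F1♯) shadow `Theorem314_geomDir` under `ē ≤ 2`).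

* `Moving.exists_genuineStep_of_pointCentre` — at a BLOWN-UP stage whose canonical centre is `𝔪` at the marked point
  (good state, `ν ≠ Φ^{(3)}`): the centre is the reduced structure on its support, the next marked point is a closed
  point of `Bℓ_C(X_n)` over `x_n`, with its local ring.
* `Moving.exists_localTower_of_movingChain_wait_of_pointCentres` — **for a MOVING chain from ANY maximal origin
  (`ν ≠ Φ^{(3)}`) whose blown-up stages are point-centred: the genuine stages `n_0 < n_1 < ⋯`, the waiting prefix, and a
  tower `T` of blow-ups of closed points over `Spec 𝒪_{X_{n_0},x_{n_0}}` with marked closed points `y_j ↦ y_{j−1}` and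
  `𝒪_{T.X j, y_j} ≅ 𝒪_{X_{n_j}, x_{n_j}}`**, plus the stage-`0` setting (`KeySetting`, `CharHypothesis`, isolation).

## References

* V. Cossart, U. Jannsen, S. Saito, LNM 2270 (2020): p. 107, Thm. 3.14, Def. 6.34, Cor. 6.37, Def. 6.38. [CossartJannsenSaito2020]
-/

noncomputable section

-- namespace `…Corridor3.Moving` re-enters `…Corridor3` (module convention of the Moving files)
set_option linter.dupNamespace false

open CategoryTheory CategoryTheory.Limits AlgebraicGeometry TopologicalSpace IsLocalRing
open Literature.AlgebraicGeometry.Resolution Literature.RingTheory.HilbertSamuel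
open Scheme.IdealSheafData

universe u

open Summit.ResolutionOfSingularities.ResolutionOfSingularities.Theorems.CampaignW42
open Literature.AlgebraicGeometry.CossartJannsenSaito2020
open Summit.ResolutionOfSingularities.ResolutionOfSingularities.Theorems.SigmaMaxModificationsCorridor3

namespace Summit.ResolutionOfSingularities.ResolutionOfSingularities.Theorems.SigmaMaxModificationsCorridor3.Moving

variable {R : ∀ S : Scheme.{u}, CentreSeq S → Prop} {ν : ℕ → ℕ}

/-! ## The genuine step, point-centred -/

/-- **THE GENUINE STEP AT A POINT-CENTRED BLOWN-UP STAGE** (fact-free core of `exists_genuineStep`): at a stage reached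
from a maximal origin with `ν ≠ Φ^{(3)}` that is blown up in its canonical step, IF the canonical centre has stalk ideal
`𝔪_{x_n}` at the marked point, then THE centre `C` is the reduced structure on its support (it is permissible, hence
regular), `C_{x_n} = 𝔪_{x_n}`, and the next marked point is a closed point `x'` of `Bℓ_C(X_n)` over `x_n` with
`𝒪_{Bℓ_C(X_n),x'} = 𝒪_{X_{n+1},x_{n+1}}`. [cite: CossartJannsenSaito2020, Def. 3.1, p. 107] -/
theorem exists_genuineStep_of_pointCentre (hRf : OracleFunctional R) (hRa : OracleAdmissible R) {p : ℕ} {X : Scheme.{u}} [IsLocallyNoetherian X] {x : X}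
    (hX : IsMaximalOrigin p 3 ν X x) (hν : ν ≠ iterPSum 3 Phi)
    {s s' : MarkedStage.{u}} (hreach : Reaches R 3 ν (MarkedStage.init X x) s) (hst : CanonicalNearStep R 3 ν s s')
    (hb : s.IsBlownUp R 3 ν)
    (hctr : ∀ (C : s.W.IdealSheafData) (P' : Option (Pending (blowup C))), IsCanonicalStep R 3 ν s.L s.P C P' →
      s.pt ∈ (C.support : Set s.W) → stalkIdeal C s.pt = maximalIdeal (s.W.presheaf.stalk s.pt)) :
    ∃ (C : s.W.IdealSheafData) (x' : ↥(blowup C)),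
      C = vanishingIdeal C.support ∧ stalkIdeal C s.pt = @maximalIdeal (s.W.presheaf.stalk s.pt) _ _ ∧
        (blowup.π C).base x' = s.pt ∧ IsClosed ({x'} : Set ↥(blowup C)) ∧
          Nonempty ((blowup C).presheaf.stalk x' ≅ s'.W.presheaf.stalk s'.pt) := by
  haveI : IsLocallyNoetherian s.W := s.ln
  obtain ⟨k, _, _, f, -, hft, hqc⟩ := hX.exists_structure
  haveI := hft
  haveI := hqc
  haveI := hX.isReduced
  have hgood : StateGood k R 3 ν s.W s.L s.P :=
    stateGood_of_reaches (stateGood_init_general hRa f hX.dim_le hX.maximal hν) hreach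
  obtain ⟨C, P', hcs, hmem⟩ := hb
  have hmax : stalkIdeal C s.pt = maximalIdeal (s.W.presheaf.stalk s.pt) :=
    hctr C P' hcs hmem
  obtain ⟨C₂, P₂', hln, x', hcs₂, hπ, hcl, -, rfl⟩ := hst
  obtain rfl : C = C₂ := IsCanonicalStep.centre_unique hRf hcs hcs₂
  have hreg : Scheme.IsRegular C.subscheme := isRegular_subscheme_of_isPermissible (hgood.isPermissible hcs)
  exact ⟨C, x', eq_vanishingIdeal_support_of_isRegular C hreg, hmax, hπ, hcl, ⟨Iso.refl _⟩⟩

/-! ## The local tower of a point-centred moving chain -/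

/-- **FROM A MOVING CHAIN TO ITS LOCAL TOWER, with the WAITING PREFIX — fact-free core** of
`exists_localTower_of_movingChain_wait`: let `c` be a chain of canonical near steps from a maximal origin `(X, x)` (any
prime, any regime) with `ν ≠ Φ^{(3)}`, blown up infinitely often, whose blown-up stages are POINT-CENTRED (the canonical
centre has stalk ideal `𝔪` at the marked point). Then there are the GENUINE STAGES `n_0 < n_1 < ⋯` (all blown-up stages
from `n_0` on, none before `n_0`) and a tower `T` of blow-ups of closed points with marked closed points `y_j ∈ T.X j`,
`T.C j = {y_j}`, `y_{j+1} ↦ y_j`, and `𝒪_{T.X j,y_j} ≅ 𝒪_{X_{n_j},x_{n_j}}` for all `j`; the setting transfers to stage `0`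
from the stage `X_{n_0}` (excellence and `dim ≤ N`, (F1), isolation in the Hilbert–Samuel locus).
[cite: CossartJannsenSaito2020, p. 107, Def. 6.34, Cor. 6.37, Def. 6.38] -/
theorem exists_localTower_of_movingChain_wait_of_pointCentres (hRf : OracleFunctional R) (hRa : OracleAdmissible R) {p : ℕ} {X : Scheme.{u}} [IsLocallyNoetherian X] {x : X}
    (hX : IsMaximalOrigin p 3 ν X x) (hν : ν ≠ iterPSum 3 Phi)
    {c : ℕ → MarkedStage.{u}} (h0 : Reaches R 3 ν (MarkedStage.init X x) (c 0))
    (hstep : ∀ n, CanonicalNearStep R 3 ν (c n) (c (n + 1))) (hmov : ∀ n, ∃ m, n ≤ m ∧ (c m).IsBlownUp R 3 ν)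
    (hctr : ∀ n (C : (c n).W.IdealSheafData) (P' : Option (Pending (blowup C))),
      IsCanonicalStep R 3 ν (c n).L (c n).P C P' → (c n).pt ∈ (C.support : Set (c n).W) →
        stalkIdeal C (c n).pt = maximalIdeal ((c n).W.presheaf.stalk (c n).pt)) :
    ∃ (g : ℕ → ℕ) (T : BlowupTower.{u}) (y : ∀ j, T.X j),
      StrictMono g ∧ (∀ j, (c (g j)).IsBlownUp R 3 ν) ∧ (∀ m, g 0 ≤ m → (c m).IsBlownUp R 3 ν → ∃ j, g j = m) ∧
      (∀ m, m < g 0 → ¬ (c m).IsBlownUp R 3 ν) ∧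
      (∀ j, T.C j = {y j}) ∧ (∀ j, IsClosed ({y j} : Set (T.X j))) ∧ (∀ j, (T.π j).base (y (j + 1)) = y j) ∧
      (∀ j, Nonempty ((T.X j).presheaf.stalk (y j) ≅ (c (g j)).W.presheaf.stalk (c (g j)).pt)) ∧
      (∀ N : ℕ, Scheme.IsExcellent (c (g 0)).W → topologicalKrullDim (c (g 0)).W ≤ (N : WithBot ℕ∞) → KeySetting T N) ∧
      (CharHypothesis (c (g 0)).W (c (g 0)).pt → CharHypothesis (T.X 0) (y 0)) ∧
      (∀ N : ℕ,
        (haveI := (c (g 0)).ln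
         IsIsolatedInHSMaxLocus (Spec ((c (g 0)).W.presheaf.stalk (c (g 0)).pt)) N
          (closedPoint ((c (g 0)).W.presheaf.stalk (c (g 0)).pt))) →
        @IsIsolatedInHSMaxLocus (T.X 0) (T.ln 0) N (y 0)) := by
  classical
  -- the genuine stages: `next n` = the first blown-up stage `≥ n`
  let next : ℕ → ℕ := fun n => Nat.find (hmov n)
  have next_spec : ∀ n, n ≤ next n ∧ (c (next n)).IsBlownUp R 3 ν := fun n => Nat.find_spec (hmov n)
  have next_min : ∀ n m, n ≤ m → (c m).IsBlownUp R 3 ν → next n ≤ m :=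
    fun n m hnm hb => Nat.find_min' (hmov n) ⟨hnm, hb⟩
  have next_wait : ∀ n m, n ≤ m → m < next n → ¬ (c m).IsBlownUp R 3 ν :=
    fun n m hnm hlt hb => absurd (next_min n m hnm hb) (not_le.mpr hlt)
  let g : ℕ → ℕ := fun j => Nat.rec (next 0) (fun _ gj => next (gj + 1)) j
  have g_zero : g 0 = next 0 := rfl
  have g_succ : ∀ j, g (j + 1) = next (g j + 1) := fun j => rfl
  have g_blown : ∀ j, (c (g j)).IsBlownUp R 3 ν := by
    intro j
    cases j with
    | zero => exact (next_spec 0).2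
    | succ j => rw [g_succ]; exact (next_spec _).2
  have g_lt : ∀ j, g j < g (j + 1) := fun j => by
    rw [g_succ]; exact Nat.lt_of_lt_of_le (Nat.lt_succ_self _) (next_spec _).1
  have g_mono : StrictMono g := strictMono_nat_of_lt_succ g_lt
  have g_all : ∀ m, g 0 ≤ m → (c m).IsBlownUp R 3 ν → ∃ j, g j = m := by
    intro m hm hb
    have hex : ∃ j, m < g (j + 1) := ⟨m, Nat.lt_of_lt_of_le (Nat.lt_succ_self m) (g_mono.id_le (m + 1))⟩
    obtain ⟨j₀, hj₀, hmin⟩ : ∃ j₀, m < g (j₀ + 1) ∧ ∀ k < j₀, ¬ m < g (k + 1) :=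
      ⟨Nat.find hex, Nat.find_spec hex, fun k hk => Nat.find_min hex hk⟩
    have hle : g j₀ ≤ m := by
      cases j₀ with
      | zero => exact hm
      | succ k => exact not_lt.mp (hmin k (Nat.lt_succ_self k))
    refine ⟨j₀, le_antisymm hle (not_lt.mp fun hlt => ?_)⟩
    have h1 : g (j₀ + 1) ≤ m := by rw [g_succ]; exact next_min _ m hlt hb
    exact absurd hj₀ (not_lt.mpr h1)
  -- the genuine step data at each `g j`
  have hreach : ∀ n, Reaches R 3 ν (MarkedStage.init X x) (c n) := reaches_chain h0 hstep
  have hgen := fun j => exists_genuineStep_of_pointCentre hRf hRa hX hν (hreach (g j)) (hstep (g j)) (g_blown j)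
    (hctr (g j))
  choose Cc x' hC hmax hπ hcl hiso using hgen
  -- links: `𝒪_{Bℓ,x'_j} ≅ 𝒪_{X_{g j + 1}} ≅ 𝒪_{X_{g (j+1)}}` (waiting segment)
  have hlink : ∀ j, Nonempty ((blowup (Cc j)).presheaf.stalk (x' j) ≅
      (c (g (j + 1))).W.presheaf.stalk (c (g (j + 1))).pt) := by
    intro j
    obtain ⟨e₁⟩ := hiso j
    obtain ⟨e₂⟩ := nonempty_stalkIso_of_waiting hstep (a := g j + 1) (b := g (j + 1))
      (by rw [g_succ]; exact (next_spec _).1) (fun m hm hlt => next_wait (g j + 1) m hm (by rw [← g_succ]; exact hlt))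
    exact ⟨e₁ ≪≫ e₂⟩
  -- the local tower
  haveI : ∀ j, IsLocallyNoetherian (c (g j)).W := fun j => (c (g j)).ln
  obtain ⟨T, y, hC', hycl, hover, hstalk, hkey, hchar, hisol⟩ :=
    exists_localTower_spec (W := fun j => (c (g j)).W) (W' := fun j => blowup (Cc j)) (fun j => blowup.π (Cc j)) Cc
      (fun j => blowup.isBlowup (Cc j)) hC (fun j => (c (g j)).pt) hmax x' hπ hcl hlink
  exact ⟨g, T, y, g_mono, g_blown, g_all, fun m hm => next_wait 0 m (Nat.zero_le m) hm, hC', hycl, hover, hstalk,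
    hkey, hchar, hisol⟩

end Summit.ResolutionOfSingularities.ResolutionOfSingularities.Theorems.SigmaMaxModificationsCorridor3.Moving

end
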